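import Summits.BirchSwinnertonDyer.Rank1Residual.X11b.SelmerCardParity
import Literature.NumberTheory.EllipticCurves.IsogenySelmerGroupsCompositeProofs
import Literature.NumberTheory.EllipticCurves.BSDRankZeroDensity
import Literature.NumberTheory.EllipticCurves.Rank1Residual.Predicates
import Literature.NumberTheory.EllipticCurves.KrizLi2019.EisensteinHeegnerLog
import HarnessLib

/-!
# Route `PrintCFram`, crux C2 `BottomClassIndexLawFiveLe` (stmt-BirchSwinnertonDyer-20372), line
# `eisenstein-resource-bdp-line` (registry v18), stub B1 `stub_bsdp_of_classFactor`: **THE PARITY SPLIT OF B1** —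
# `#Sel_p(W/ℚ) ≤ p²` ∧ `p ∤ #Ш_an(W)` ⟹ `BSDp W p` for every rank-one member (Cassels–Tate parity, tree cell X11b),
# the isogeny-Selmer form `#Sel^φ·#Sel^{φ̂} ≤ p²`, and B1 ⟸ B1-sel ∧ B1-an as a kernel reduction
# (cell `bsd-print-cfram`, seat `bsd-line-cfram-p1-w2` g8; helper `--supports` 20372; 0 defs, 0 facts, 0 sorry)

HONEST FRAMING. Nothing about BSD is proved unconditionally here, no stub is closed, and nothing here is new number theory: it is GLUE
around the tree's `Summit.BirchSwinnertonDyer.Rank1Residual.X11b.bsdp_of_card_selmerGroup_le_of_casselsTate` (granting the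
Cassels–Tate pairing `hCT` — Cassels 1962, a refereed print fact — and Gross–Zagier–Kolyvagin `hGZK` = the crux's own antecedent:
`dim_𝔽_p Ш(E/ℚ)[p]` is EVEN, so in analytic rank one `#Sel_p(E/ℚ) ≤ p²` forces `Ш(E/ℚ)[p^∞] = 0`, and with `p ∤ #Ш_an` Miller's last
clause holds). WHY IT IS FILED ON THIS CRUX (companion note `Lines/eisenstein-resource-bdp-line-w2g8-notes.md` §3–§4): the Kolyvagin lane
cannot reach `Ш(W)[p]^{ε} = 0` for the inhabited off-locus members (`M₀ = 0`, `p`-regular Heegner twist: the one lost `p` is real there),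
while the φ-DESCENT COUNT of LEAD g10's anatomy (`#Sel_p ≤ #Sel^φ·#Sel^{φ̂}`, Wiles' formula `dim R_rel(θ) − dim R_str(ωθ⁻¹) = 1 − [θ even]`)
gives `dim Sel_p(W/ℚ) ≤ 2·u(ψ)` in the «ψ-strict» alignment and `≤ 2·u(θ_e) + 1` in the other (`u(θ)` = dimension of the everywhere-
unramified classes of `𝔽_p(θ)`), i.e. `≤ 2` on the branch «ψ-strict ∧ u(ψ) = 1» (⟸ `v_p(B_{1,ψ⁻¹}) = 1`, the census value of both inhabited
members) and `≤ 1` on «ψ-relaxed ∧ u(θ_e) = 0». On those branches B1 is therefore EXACTLY `p ∤ #Ш_an(W)` — by Gross–Zagier at a Heegner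
field with `p`-regular twist, the `p`-PRIMITIVITY of the Heegner point (the second-order residue); `Ш` is not the obstruction.

* §1 `natCard_selmerGroup_le_of_comp_eq_zsmul` — `#Sel_n(E/K) ≤ #Sel^φ(E) · #Sel^ψ(E')` for isogenies `φ : E → E'`, `ψ : E' → E`
  with `ψ ∘ φ = [n]` (the tree's `Isogeny.natCard_selmerGroup_le_mul` + `natCard_selmerGroup_eq_of_forall_eq_zsmul`; the tree states the
  case `n = 3` as `natCard_selmerGroup_three_le`).
* §2 **`bsdp_of_natCard_selmerGroup_le_sq`** — `hCT → hGZK → r_an(W) = 1 → shaAn W = q → padicValRat p q = 0 → #Sel_p(W/ℚ) ≤ p² → BSDp W p`;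
  `bsdp_of_isogeny_selmer_le_sq` — the same from `#Sel^φ(W)·#Sel^ψ(W') ≤ p²` for a pair `ψ ∘ φ = [p]` (the CM-ramified `p`-isogeny
  `W → W/W[𝔭] → W`).
* §3 **`bsdp_of_classFactor_of_selLeSq_of_shaAnUnit`** — B1 VERBATIM (the registered signature of `stub_bsdp_of_classFactor`, v17/v18)
  from `hCT`, `hGZK` and the two halves in B1's own binders: **B1-sel** «… → Nat.card (W.selmerGroup p) ≤ p ^ 2» and **B1-an**
  «… → ∃ q, shaAn W = q ∧ padicValRat p q = 0». (If B1 stays class-wide, members with `#Sel_p ≥ p³` — `Ш(W)[p] ≠ 0`, none on the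
  window — are outside B1-sel: B1-sel is then false for them and the ORDER form (`…BorelOrderTelescope*`) is the residue; the split is a
  dichotomy per member, recorded here as an implication only.)

THEOREMS ONLY; no definition, no named fact, no `sorry`. BSD is not proved by any of this; no summit statement is proved by this seat.
References: [Cassels1962ArithmeticIV]; [SilvermanAEC2009] Thm X.4.14, X.4.2; [Miller2011LMS] Def. 1.1; [SchaeferStoll2004] §6–7
(isogeny descent); the LEAD g10 report §2 and these seat notes §4.
-/

set_option autoImplicit false
-- `…BirchSwinnertonDyer.BirchSwinnertonDyer.Theorems…` is the problem's mandated namespace (D-0017).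
set_option linter.dupNamespace false

noncomputable section

open scoped Classical

namespace Summit.BirchSwinnertonDyer.BirchSwinnertonDyer.Theorems.PrintCFram.ParitySplit

open WeierstrassCurve Literature.NumberTheory.EllipticCurves
  Literature.NumberTheory.EllipticCurves.Rank1Residual
  Literature.NumberTheory.EllipticCurves.KrizLi2019
  Summit.BirchSwinnertonDyer.Rank1Residual

universe u

/-! ## §1 `#Sel_n ≤ #Sel^φ · #Sel^ψ` for `ψ ∘ φ = [n]` -/

section IsogenyDescent

variable {K : Type} [Field K] [NumberField K] {W W' : WeierstrassCurve K} [W.IsElliptic] [W'.IsElliptic]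

/-- **Isogeny descent count**: for isogenies `φ : E → E'`, `ψ : E' → E` with `ψ ∘ φ = [n]` on geometric points,
`#Sel^{(n)}(E/K) ≤ #Sel^φ(E/K) · #Sel^ψ(E'/K)` (the exact sequence `Sel^φ(E) → Sel^{ψφ}(E) → Sel^ψ(E')`; the tree's
`Isogeny.natCard_selmerGroup_le_mul` with `Sel^{ψ∘φ} = Sel^{(n)}`). [cite: SchaeferStoll2004, Lemma 6.1 / §7] -/
theorem natCard_selmerGroup_le_of_comp_eq_zsmul (φ : Isogeny W W') (ψ : Isogeny W' W) {n : ℤ}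
    (h : ∀ P, ψ (φ P) = n • P) :
    Nat.card (W.selmerGroup n) ≤ Nat.card φ.selmerGroup * Nat.card ψ.selmerGroup := by
  have hcomp : ∀ P, ψ (φ P) = ψ.comp φ P := fun P ↦ (Isogeny.comp_apply ψ φ P).symm
  rw [← (ψ.comp φ).natCard_selmerGroup_eq_of_forall_eq_zsmul (n := n)
    (fun P ↦ by rw [Isogeny.comp_apply, h])]
  exact Isogeny.natCard_selmerGroup_le_mul φ ψ (ψ.comp φ) hcomp

end IsogenyDescent

/-! ## §2 `#Sel_p(W/ℚ) ≤ p²` and `p ∤ #Ш_an(W)` give `BSD(W,p)` in analytic rank one -/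

section Parity

variable (W : WeierstrassCurve ℚ) [W.IsElliptic] (p : ℕ) [hp : Fact p.Prime]

/-- **The parity squeeze in analytic rank one.** Granting the Cassels–Tate pairing (`hCT`, Cassels 1962) and
Gross–Zagier–Kolyvagin (`hGZK`: `rank = r_an`, `Ш` finite for `r_an ≤ 1`): if `r_an(W) = 1`, `#Ш_an(W)` is a rational `p`-adic unit
and `#Sel^{(p)}(W/ℚ) ≤ p²`, then `BSD(W,p)`. (`#Sel_p = p^k` with `k ≤ 2 = r_an + 1`, then X11b's
`bsdp_of_card_selmerGroup_le_of_casselsTate`: `dim Ш[p]` is even, so `Ш[p] = 0`.)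
[cite: Cassels1962ArithmeticIV] [cite: Miller2011LMS, Def. 1.1] -/
theorem bsdp_of_natCard_selmerGroup_le_sq (hCT : exists_casselsTate_pairing (K := ℚ))
    (hGZK : rank_eq_analyticRank_of_analyticRank_le_one) (hr : W.analyticRank = 1) {q : ℚ}
    (hq : shaAn W = (q : ℂ)) (hv : padicValRat p q = 0)
    (hcard : Nat.card (W.selmerGroup (p : ℤ)) ≤ p ^ 2) : BSDp W p := by
  obtain ⟨k, hk⟩ := exists_natCard_selmerGroup_eq_pow W p
  have hk2 : k ≤ 2 := by
    rw [hk] at hcard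
    exact (Nat.pow_le_pow_iff_right hp.out.one_lt).mp hcard
  exact X11b.bsdp_of_card_selmerGroup_le_of_casselsTate W p hCT hGZK (by rw [hr]) hq hv hk (by rw [hr]; omega)

/-- **The same from the isogeny count**: for a pair of isogenies `φ : W → W'`, `ψ : W' → W` over `ℚ` with `ψ ∘ φ = [p]` (for a
CM-ramified class member: `W → W/W[𝔭] → W`) and `#Sel^φ(W)·#Sel^ψ(W') ≤ p²`, together with `r_an(W) = 1`, `p ∤ #Ш_an(W)`, `hCT`, `hGZK`:
`BSD(W,p)`. [cite: Cassels1962ArithmeticIV] [cite: SchaeferStoll2004, §7] -/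
theorem bsdp_of_isogeny_selmer_le_sq (hCT : exists_casselsTate_pairing (K := ℚ))
    (hGZK : rank_eq_analyticRank_of_analyticRank_le_one) (hr : W.analyticRank = 1) {q : ℚ}
    (hq : shaAn W = (q : ℂ)) (hv : padicValRat p q = 0)
    {W' : WeierstrassCurve ℚ} [W'.IsElliptic] (φ : Isogeny W W') (ψ : Isogeny W' W)
    (h : ∀ P, ψ (φ P) = (p : ℤ) • P)
    (hle : Nat.card φ.selmerGroup * Nat.card ψ.selmerGroup ≤ p ^ 2) : BSDp W p :=
  bsdp_of_natCard_selmerGroup_le_sq W p hCT hGZK hr hq hv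
    ((natCard_selmerGroup_le_of_comp_eq_zsmul φ ψ h).trans hle)

end Parity

/-! ## §3 B1 ⟸ B1-sel ∧ B1-an (verbatim registered signature of `stub_bsdp_of_classFactor`) -/

/-- **B1 from its two halves.** The registered statement of `stub_bsdp_of_classFactor` (registry v17/v18 of the line: every CM-ramified
rank-one member, `p ≥ 5`, with an odd Kriz–Li triple `(f, ψ, ω)` satisfying the trace form and a NON-UNIT class factor
`‖B_{1,ψ⁻¹}‖ ≤ p⁻¹`, satisfies `BSD(W,p)`) follows — granting `hCT` (Cassels 1962) and `hGZK` (the crux's antecedent) — from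
**B1-sel** (the same binders ⟹ `#Sel^{(p)}(W/ℚ) ≤ p²`; first-order, the φ-descent count) and **B1-an** (the same binders ⟹ `#Ш_an(W)` is a
rational `p`-adic unit; the Heegner-primitivity residue). [cite: Cassels1962ArithmeticIV] [cite: Miller2011LMS, Def. 1.1] -/
theorem bsdp_of_classFactor_of_selLeSq_of_shaAnUnit (hCT : exists_casselsTate_pairing (K := ℚ))
    (hGZK : rank_eq_analyticRank_of_analyticRank_le_one)
    (hsel : ∀ (W : WeierstrassCurve ℚ) [W.IsElliptic] [W.IsGloballyMinimal] (p : ℕ) [Fact p.Prime],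
      W.HasCM → CMRamified W p → 5 ≤ p → W.analyticRank = 1 →
      ∀ (f : ℕ) [NeZero f] (ψ : DirichletCharacter ℚ_[p] f) (ω : DirichletCharacter ℚ_[p] p),
        ψ.Odd → KrizLi2019.IsTeichmullerCharacter ω →
        (∀ ℓ : ℕ, ℓ.Prime → ¬ (ℓ ∣ p * W.conductorNorm ℤ) →
          ‖((W.LFunction ℓ : ℤ) : ℚ_[p]) - (ψ (ℓ : ZMod f) + ψ⁻¹ (ℓ : ZMod f) * ω (ℓ : ZMod p))‖ < 1) →
        ‖KrizLi2019.bernoulliOnePrim ψ⁻¹‖ ≤ (p : ℝ)⁻¹ →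
        Nat.card (W.selmerGroup (p : ℤ)) ≤ p ^ 2)
    (han : ∀ (W : WeierstrassCurve ℚ) [W.IsElliptic] [W.IsGloballyMinimal] (p : ℕ) [Fact p.Prime],
      W.HasCM → CMRamified W p → 5 ≤ p → W.analyticRank = 1 →
      ∀ (f : ℕ) [NeZero f] (ψ : DirichletCharacter ℚ_[p] f) (ω : DirichletCharacter ℚ_[p] p),
        ψ.Odd → KrizLi2019.IsTeichmullerCharacter ω →
        (∀ ℓ : ℕ, ℓ.Prime → ¬ (ℓ ∣ p * W.conductorNorm ℤ) →
          ‖((W.LFunction ℓ : ℤ) : ℚ_[p]) - (ψ (ℓ : ZMod f) + ψ⁻¹ (ℓ : ZMod f) * ω (ℓ : ZMod p))‖ < 1) →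
        ‖KrizLi2019.bernoulliOnePrim ψ⁻¹‖ ≤ (p : ℝ)⁻¹ →
        ∃ q : ℚ, shaAn W = (q : ℂ) ∧ padicValRat p q = 0) :
    ∀ (W : WeierstrassCurve ℚ) [W.IsElliptic] [W.IsGloballyMinimal] (p : ℕ) [Fact p.Prime],
      W.HasCM → CMRamified W p → 5 ≤ p → W.analyticRank = 1 →
      ∀ (f : ℕ) [NeZero f] (ψ : DirichletCharacter ℚ_[p] f) (ω : DirichletCharacter ℚ_[p] p),
        ψ.Odd → KrizLi2019.IsTeichmullerCharacter ω →
        (∀ ℓ : ℕ, ℓ.Prime → ¬ (ℓ ∣ p * W.conductorNorm ℤ) →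
          ‖((W.LFunction ℓ : ℤ) : ℚ_[p]) - (ψ (ℓ : ZMod f) + ψ⁻¹ (ℓ : ZMod f) * ω (ℓ : ZMod p))‖ < 1) →
        ‖KrizLi2019.bernoulliOnePrim ψ⁻¹‖ ≤ (p : ℝ)⁻¹ →
        BSDp W p := by
  intro W _ _ p _ hCM hram h5 hr f _ ψ ω hψ hω hss hB
  obtain ⟨q, hq, hv⟩ := han W p hCM hram h5 hr f ψ ω hψ hω hss hB
  exact bsdp_of_natCard_selmerGroup_le_sq W p hCT hGZK hr hq hv (hsel W p hCM hram h5 hr f ψ ω hψ hω hss hB)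

end Summit.BirchSwinnertonDyer.BirchSwinnertonDyer.Theorems.PrintCFram.ParitySplit

end
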